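import Summits.BirchSwinnertonDyer.BirchSwinnertonDyer.Theorems.UniversalToricDescentResidualLayerAlgebra
import Literature.NumberTheory.EllipticCurves.IwasawaAlgebraMuAdditiveProofs
import Literature.NumberTheory.EllipticCurves.IwasawaModuleFinitePadicIntProofs
import Literature.NumberTheory.EllipticCurves.IwasawaAlgebraProofs
import Literature.NumberTheory.EllipticCurves.IwasawaAlgebraCharIdealProofs
import Literature.NumberTheory.EllipticCurves.BSDRootNumber
import Summits.BirchSwinnertonDyer.BirchSwinnertonDyer.Theorems.UniversalToricDescentTwoSidedMuTransfer
import HarnessLib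

/-!
# Route UniversalToricDescent — the RESIDUAL CORANK-ONE μ-CRITERION over `Λ = ℤ_p⟦T⟧` (and the rank-two residual
# growth bound over `Ω = k⟦T⟧` it rests on), any prime `p`

Lead prover bsd-wall-utd-p1 g21 (`--supports stmt-BirchSwinnertonDyer-24737`). This is THE algebra gap of the node
`Cruxes/TwinAlgMuZeroAtThree/Lines/residual_omega_kolyvagin.lean` (cruxidea-24737-1 g0; transfer stubs T1_B/T1_C), as
isolated in the LEAD memo `Cruxes/TwinAlgMuZeroAtThree/LEAD-utd-p1-g21-residual-corank-gap.md`: «residual corank ≤ 1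
growth ∧ Λ-rank ≥ 1 ⟹ μ(X_tors) = 0». Its rank-ZERO companion is the landed one-layer criterion
(`…ResidualLayerAlgebra` p719257, `…OneLayerCriterion` p723050/p725052).

* §1 (over `Ω = k⟦X⟧`, `k` finite) `…ResidualRankTwoGrowth.pow_mul_pow_le_natCard_quotient`: `V` finitely generated,
  `W ≤ V` with `W` and `V ⧸ W` both NOT torsion ⟹ `(#k)^m · (#k)^m ≤ #(V ⧸ T^m V)` for all `m`. Proof without a
  snake correction term: `V ⧸ W ↠ Ω` (g20 `exists_surjective_of_not_isTorsion`) with kernel `K ⊇ W` (again non-torsion);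
  `K ∩ T^m V = T^m K` because `Ω` is a domain; Lagrange `#(V/T^mV) = #((K+T^mV)/T^mV) · #(V/(K+T^mV))`
  (Mathlib `Submodule.card_quotient_mul_card_quotient`) with `(K+T^mV)/T^mV ↞≅ K/T^mK` and `V/(K+T^mV) ↠ Ω/T^m`,
  each factor `≥ (#k)^m` by g20 `pow_le_natCard_quotient_of_not_isTorsion` / `natCard_quotient_X_pow`.
* §2 (over `Λ`) **`…ResidualCorankOne.muInvariant_torsion_eq_zero_of_residual_growth`**: `M` finitely generated,
  NOT torsion, and `#((M/pM) ⧸ T^{pⁿ}) ≤ p^{pⁿ + C}` for all `n` ⟹ `μ(M_tors) = 0`. Proof: `V = M/pM` is an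
  `Ω`-module through `φ = PowerSeries.map (residue) : Λ ↠ 𝔽_p⟦X⟧` (kernel `(p)`, tree `map_residue_eq_zero_iff`;
  `Function.Surjective.moduleLeft`, inside the proof only); `W` = image of `M_tors` `≅ M_tors/p·M_tors` (the torsion
  submodule is `p`-saturated); `V/W ≅ F/pF`, `F = M/M_tors`, is infinite (else `F` torsion by the tree's
  `isTorsion_of_finite_quotient_augIdealP`, so `M` torsion); if `μ(M_tors) ≠ 0` then `W` is infinite (tree
  `muInvariant_eq_zero_of_finite_quotient_augIdealP`); §1 at `m = pⁿ > C` contradicts the growth hypothesis.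
  (`(p, ω_n) = (p, T^{pⁿ})`, so the hypothesis is the X-side form of «#Sel[p]^{Γ_n} ≤ p^{pⁿ+C}» through the dual pair.)

THEOREMS ONLY (no definition, no named fact, no `sorry`); no `Theses` import. BSD is not advanced by this file; stmt-24737
stays open (this closes only the Λ-algebra between the node's R1 and the landed two-sided files).
References: [Washington1997] §13.2; [GreenbergVatsal2000] §2 Prop. (2.8); folklore over the DVR `𝔽_p⟦T⟧`.
-/

set_option linter.dupNamespace false
set_option autoImplicit false

noncomputable section

open scoped Classical
open PowerSeries

namespace Summit.BirchSwinnertonDyer.BirchSwinnertonDyer.Theorems.UniversalToricDescentResidualRankTwoGrowth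

open Summit.BirchSwinnertonDyer.BirchSwinnertonDyer.Theorems.UniversalToricDescentResidualLayerAlgebra

universe u v

variable {k : Type u} [Field k] {V : Type v} [AddCommGroup V] [Module k⟦X⟧ V]

/-- A submodule of a torsion module is torsion; contrapositive form used below: if `W ≤ K` and `W` is not
torsion then `K` is not torsion. [folklore] -/
theorem not_isTorsion_of_le {W K : Submodule k⟦X⟧ V} (hWK : W ≤ K) (hW : ¬ Module.IsTorsion k⟦X⟧ W) :
    ¬ Module.IsTorsion k⟦X⟧ K := fun hK =>
  hW (Literature.NumberTheory.EllipticCurves.isTorsion_of_injective (Submodule.inclusion hWK)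
    (Submodule.inclusion_injective hWK) hK)

/-- **Rank-two residual growth.** `V` finitely generated over `Ω = k⟦T⟧` (`k` finite), `W ≤ V` with `W` and
`V ⧸ W` both NOT torsion ⟹ `(#k)^m · (#k)^m ≤ #(V ⧸ T^m V)` for every `m`. [cite: Washington1997, §13.2] -/
theorem pow_mul_pow_le_natCard_quotient [Finite k] [Module.Finite k⟦X⟧ V] (W : Submodule k⟦X⟧ V)
    (hW : ¬ Module.IsTorsion k⟦X⟧ W) (hQ : ¬ Module.IsTorsion k⟦X⟧ (V ⧸ W)) (m : ℕ) :
    Nat.card k ^ m * Nat.card k ^ m ≤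
      Nat.card (V ⧸ (Ideal.span {(X : k⟦X⟧) ^ m} • (⊤ : Submodule k⟦X⟧ V))) := by
  haveI : IsNoetherian k⟦X⟧ V := isNoetherian_of_isNoetherianRing_of_finite _ _
  -- a surjection `ψ : V ⧸ W ↠ Ω`, pulled back to `V`
  obtain ⟨ψQ, hψQ⟩ := exists_surjective_of_not_isTorsion hQ
  let ψ : V →ₗ[k⟦X⟧] k⟦X⟧ := ψQ.comp W.mkQ
  have hψ : Function.Surjective ψ := hψQ.comp W.mkQ_surjective
  let K : Submodule k⟦X⟧ V := LinearMap.ker ψ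
  have hWK : W ≤ K := fun w hw => by
    change ψQ (W.mkQ w) = 0
    rw [Submodule.mkQ_apply, (Submodule.Quotient.mk_eq_zero W).mpr hw, map_zero]
  have hK : ¬ Module.IsTorsion k⟦X⟧ K := not_isTorsion_of_le hWK hW
  haveI : Module.Finite k⟦X⟧ K := Module.Finite.iff_fg.mpr (IsNoetherian.noetherian K)
  -- notation
  let I : Ideal k⟦X⟧ := Ideal.span {(X : k⟦X⟧) ^ m}
  let S : Submodule k⟦X⟧ V := I • ⊤
  have hXm0 : ((X : k⟦X⟧) ^ m) ≠ 0 := pow_ne_zero m PowerSeries.X_ne_zero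
  -- (1) `K ⊓ S ≤ T^m K`: if `T^m u ∈ K` then `ψ u = 0`
  have hKS : ∀ v ∈ K, v ∈ S → ∃ u ∈ K, v = ((X : k⟦X⟧) ^ m) • u := by
    intro v hvK hvS
    rw [show S = I • ⊤ from rfl, Submodule.ideal_span_singleton_smul,
      Submodule.mem_smul_pointwise_iff_exists] at hvS
    obtain ⟨u, -, rfl⟩ := hvS
    refine ⟨u, ?_, rfl⟩
    have h0 : ψ (((X : k⟦X⟧) ^ m) • u) = 0 := hvK
    rw [map_smul, smul_eq_mul, mul_eq_zero] at h0
    exact h0.resolve_left hXm0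
  -- (2) Lagrange: `#(V/S) = #B · #(V/(K ⊔ S))` with `B = (K ⊔ S).map S.mkQ`
  have hlag := Submodule.card_quotient_mul_card_quotient (K ⊔ S) S le_sup_right
  haveI hVS : Finite (V ⧸ S) := finite_quotient_X_pow_smul_top (k := k) m
  -- (3) `#(V/(K ⊔ S)) ≥ #(Ω/T^m)`: `ψ` induces `V/(K ⊔ S) ↠ Ω/(T^m)`
  have hle₁ : (K ⊔ S) ≤ Submodule.comap ψ (I.restrictScalars k⟦X⟧) := by
    rw [sup_le_iff]
    constructor
    · intro v hv
      rw [Submodule.mem_comap, Submodule.restrictScalars_mem, LinearMap.mem_ker.mp hv]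
      exact Submodule.zero_mem _
    · rw [show S = I • ⊤ from rfl, ← Submodule.map_le_iff_le_comap, Submodule.map_smul'']
      refine (Submodule.smul_mono le_rfl le_top).trans ?_
      intro f hf
      rw [Submodule.restrictScalars_mem]
      have : I • (⊤ : Submodule k⟦X⟧ k⟦X⟧) = I := by rw [Ideal.smul_eq_mul, Ideal.mul_top]
      rw [← this]; exact hf
  let θ := Submodule.mapQ (K ⊔ S) (I.restrictScalars k⟦X⟧) ψ hle₁
  have hθ : Function.Surjective θ := by
    intro y
    induction y using Submodule.Quotient.induction_on with
    | H f =>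
      obtain ⟨x, rfl⟩ := hψ f
      exact ⟨Submodule.Quotient.mk x, by rw [Submodule.mapQ_apply]⟩
  haveI : Finite (V ⧸ (K ⊔ S)) :=
    Finite.of_surjective (Submodule.mapQ S (K ⊔ S) LinearMap.id le_sup_right) (fun y => by
      induction y using Submodule.Quotient.induction_on with
      | H x => exact ⟨Submodule.Quotient.mk x, by rw [Submodule.mapQ_apply, LinearMap.id_apply]⟩)
  have hcard₁ : Nat.card k ^ m ≤ Nat.card (V ⧸ (K ⊔ S)) := by
    calc Nat.card k ^ m = Nat.card (k⟦X⟧ ⧸ I) := (natCard_quotient_X_pow m).symm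
      _ = Nat.card (k⟦X⟧ ⧸ I.restrictScalars k⟦X⟧) := by rw [Submodule.restrictScalars_self]
      _ ≤ Nat.card (V ⧸ (K ⊔ S)) := Nat.card_le_card_of_surjective θ hθ
  -- (4) `#B ≥ #(K/T^m K)` for `B = (K ⊔ S).map S.mkQ`: with `κ = mkQ ∘ subtype : K → V/S`,
  --     `ker κ ≤ T^m K` by (1), so `K/T^m K ↞ K/ker κ ≅ range κ ≤ B`
  let B : Submodule k⟦X⟧ (V ⧸ S) := (K ⊔ S).map S.mkQ
  haveI : Finite B := Finite.of_injective (fun b : B => (b : V ⧸ S)) Subtype.val_injective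
  let κ : K →ₗ[k⟦X⟧] (V ⧸ S) := S.mkQ.comp K.subtype
  let SK : Submodule k⟦X⟧ K := I • ⊤
  have hker : LinearMap.ker κ ≤ SK := by
    intro u hu
    rw [LinearMap.mem_ker, LinearMap.comp_apply, Submodule.coe_subtype, Submodule.mkQ_apply,
      Submodule.Quotient.mk_eq_zero] at hu
    obtain ⟨u', hu'K, hu'⟩ := hKS u u.2 hu
    rw [show SK = I • ⊤ from rfl, Submodule.ideal_span_singleton_smul, Submodule.mem_smul_pointwise_iff_exists]
    exact ⟨⟨u', hu'K⟩, Submodule.mem_top, Subtype.ext (by rw [Submodule.coe_smul]; exact hu'.symm)⟩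
  have hrange : LinearMap.range κ ≤ B := by
    rw [LinearMap.range_comp, Submodule.range_subtype]
    exact Submodule.map_mono le_sup_left
  haveI : Finite (LinearMap.range κ) := Finite.of_injective _ (Submodule.inclusion_injective hrange)
  haveI : Finite (K ⧸ LinearMap.ker κ) := Finite.of_equiv _ (LinearMap.quotKerEquivRange κ).toEquiv.symm
  have hker' : LinearMap.ker κ ≤ SK.comap LinearMap.id := by rwa [Submodule.comap_id]
  let σ : (K ⧸ LinearMap.ker κ) →ₗ[k⟦X⟧] (K ⧸ SK) := Submodule.mapQ _ _ LinearMap.id hker'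
  have hσ : Function.Surjective σ := fun y => by
    induction y using Submodule.Quotient.induction_on with
    | H u => exact ⟨Submodule.Quotient.mk u, by rw [Submodule.mapQ_apply, LinearMap.id_apply]⟩
  have hcard₂ : Nat.card k ^ m ≤ Nat.card B :=
    calc Nat.card k ^ m ≤ Nat.card (K ⧸ SK) := pow_le_natCard_quotient_of_not_isTorsion (k := k) (M := K) m hK
      _ ≤ Nat.card (K ⧸ LinearMap.ker κ) := Nat.card_le_card_of_surjective σ hσ
      _ = Nat.card (LinearMap.range κ) := Nat.card_congr (LinearMap.quotKerEquivRange κ).toEquiv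
      _ ≤ Nat.card B := Nat.card_le_card_of_injective _ (Submodule.inclusion_injective hrange)
  -- (5) assemble
  calc Nat.card k ^ m * Nat.card k ^ m ≤ Nat.card B * Nat.card (V ⧸ (K ⊔ S)) :=
        Nat.mul_le_mul hcard₂ hcard₁
    _ = Nat.card (V ⧸ S) := hlag


end Summit.BirchSwinnertonDyer.BirchSwinnertonDyer.Theorems.UniversalToricDescentResidualRankTwoGrowth

/-! ## The residual corank-one μ-criterion over `Λ = ℤ_p⟦T⟧` -/

namespace Summit.BirchSwinnertonDyer.BirchSwinnertonDyer.Theorems.UniversalToricDescentResidualCorankOne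

open Literature.NumberTheory.EllipticCurves Literature.NumberTheory.EllipticCurves.IwasawaAlgebra
  Literature.NumberTheory.EllipticCurves.IwasawaModuleFinitePadicInt
  Summit.BirchSwinnertonDyer.BirchSwinnertonDyer.Theorems.UniversalToricDescentResidualLayerAlgebra
  Summit.BirchSwinnertonDyer.BirchSwinnertonDyer.Theorems.UniversalToricDescentResidualRankTwoGrowth

variable {p : ℕ} [Fact p.Prime]
variable {M : Type*} [AddCommGroup M] [Module (IwasawaAlgebra p) M]

/-- `p·x ∈ torsion ⟹ x ∈ torsion`: the torsion submodule is saturated with respect to the non-zero-divisor `p`.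
[folklore] -/
theorem mem_torsion_of_C_smul_mem {x : M}
    (hx : (PowerSeries.C (p : ℤ_[p]) : IwasawaAlgebra p) • x ∈ Submodule.torsion (IwasawaAlgebra p) M) :
    x ∈ Submodule.torsion (IwasawaAlgebra p) M := by
  obtain ⟨a, ha⟩ := (Submodule.mem_torsion_iff _).mp hx
  refine (Submodule.mem_torsion_iff _).mpr ⟨a * ⟨PowerSeries.C (p : ℤ_[p]), (prime_C p).ne_zero |>
    mem_nonZeroDivisors_of_ne_zero⟩, ?_⟩
  rw [Submonoid.smul_def, Submonoid.coe_mul, mul_smul]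
  exact ha

/-- **THE RESIDUAL CORANK-ONE μ-CRITERION.** Let `M` be a finitely generated `Λ`-module which is NOT torsion
(rank ≥ 1) and whose residual layers grow at most like ONE copy of `Ω = 𝔽_p⟦T⟧`:
`#((M/pM) ⧸ T^{pⁿ}) ≤ p^{pⁿ + C}` for all `n`. Then `μ(M_tors) = 0`. Proof: in `V = M/pM` (an `Ω`-module) let
`W` = image of `M_tors` (`≅ M_tors/p·M_tors`) and `Q = V/W` (`≅ F/pF`, `F = M/M_tors`); `Q` is infinite since
otherwise `F` would be torsion (tree `isTorsion_of_finite_quotient_augIdealP`); if `μ(M_tors) ≠ 0` then `W` is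
infinite too (tree `muInvariant_eq_zero_of_finite_quotient_augIdealP`), and the rank-two growth bound
`#(V/T^m V) ≥ p^{2m}` contradicts the hypothesis at `m = pⁿ > C`. The rank-ZERO companion is the landed one-layer
criterion. [cite: Washington1997, §13.2] [cite: GreenbergVatsal2000, §2 Prop. (2.8)] -/
theorem muInvariant_torsion_eq_zero_of_residual_growth [Module.Finite (IwasawaAlgebra p) M]
    (hM : ¬ Module.IsTorsion (IwasawaAlgebra p) M) (C : ℕ)
    (hgrowth : ∀ n : ℕ, Nat.card ((M ⧸ (augIdealP p • (⊤ : Submodule (IwasawaAlgebra p) M))) ⧸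
      (Ideal.span {((PowerSeries.X : IwasawaAlgebra p) ^ (p ^ n))} •
        (⊤ : Submodule (IwasawaAlgebra p) (M ⧸ (augIdealP p • (⊤ : Submodule (IwasawaAlgebra p) M)))))) ≤
      p ^ (p ^ n + C)) :
    muInvariant p (Submodule.torsion (IwasawaAlgebra p) M) = 0 := by
  haveI : IsNoetherian (IwasawaAlgebra p) M := isNoetherian_of_isNoetherianRing_of_finite _ _
  set t := Submodule.torsion (IwasawaAlgebra p) M with ht
  haveI : Module.Finite (IwasawaAlgebra p) t := Module.Finite.iff_fg.mpr (IsNoetherian.noetherian t)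
  have httors : Module.IsTorsion (IwasawaAlgebra p) t := Submodule.torsion_isTorsion
  set 𝔞 : Ideal (IwasawaAlgebra p) := augIdealP p with h𝔞
  set P : Submodule (IwasawaAlgebra p) M := 𝔞 • ⊤ with hP
  -- `V = M/pM`, `W' = image of t`, and the two infinitude facts, all over `Λ`
  let V := M ⧸ P
  let W' : Submodule (IwasawaAlgebra p) V := t.map P.mkQ
  -- (a) `V ⧸ W'` infinite: else `F = M/t` is torsion, hence `M` is torsion
  have hQinf : Infinite (V ⧸ W') := by
    by_contra hfin
    rw [not_infinite_iff_finite] at hfin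
    -- `(M/t)/p ≅ M/(t ⊔ P) ≅ (M/P)/W'`
    let F := M ⧸ t
    have e1 : (F ⧸ (𝔞 • (⊤ : Submodule (IwasawaAlgebra p) F))) ≃ₗ[IwasawaAlgebra p] M ⧸ (t ⊔ P) := by
      have hmap : (𝔞 • (⊤ : Submodule (IwasawaAlgebra p) F)) = P.map t.mkQ := by
        rw [hP, Submodule.map_smul'', Submodule.map_top, Submodule.range_mkQ]
      exact (Submodule.quotEquivOfEq _ _ hmap).trans (Submodule.quotientQuotientEquivQuotientSup t P)
    have e2 : (V ⧸ W') ≃ₗ[IwasawaAlgebra p] M ⧸ (P ⊔ t) := Submodule.quotientQuotientEquivQuotientSup P t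
    haveI : Finite (F ⧸ (𝔞 • (⊤ : Submodule (IwasawaAlgebra p) F))) := by
      refine Finite.of_equiv (V ⧸ W') (e2.toEquiv.trans ((Submodule.quotEquivOfEq (P ⊔ t) (t ⊔ P) (sup_comm P t)).toEquiv.trans
        e1.toEquiv.symm))
    have hF : Module.IsTorsion (IwasawaAlgebra p) F := isTorsion_of_finite_quotient_augIdealP p F ‹_›
    exact hM (Summit.BirchSwinnertonDyer.BirchSwinnertonDyer.Theorems.UniversalToricDescentTwoSidedMuTransfer.isTorsion_of_exact
      t.subtype t.mkQ (LinearMap.exact_subtype_mkQ t) httors hF)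
  -- (b) if `μ(t) ≠ 0` then `W'` is infinite
  by_contra hμ
  have hWinf : Infinite W' := by
    by_contra hfin
    rw [not_infinite_iff_finite] at hfin
    apply hμ
    refine muInvariant_eq_zero_of_finite_quotient_augIdealP p t httors ?_
    -- `t ⧸ p t ≅ W'`: the kernel of `t → M/P` is `P ⊓ t = p·t`
    let κ : t →ₗ[IwasawaAlgebra p] V := P.mkQ.comp t.subtype
    have hker : LinearMap.ker κ = 𝔞 • (⊤ : Submodule (IwasawaAlgebra p) t) := by
      apply le_antisymm
      · intro x hx
        rw [LinearMap.mem_ker, LinearMap.comp_apply, Submodule.coe_subtype, Submodule.mkQ_apply,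
          Submodule.Quotient.mk_eq_zero, hP, h𝔞, augIdealP, Submodule.ideal_span_singleton_smul,
          Submodule.mem_smul_pointwise_iff_exists] at hx
        obtain ⟨y, -, hy⟩ := hx
        have hyt : y ∈ t := mem_torsion_of_C_smul_mem (by rw [hy]; exact x.2)
        rw [h𝔞, augIdealP, Submodule.ideal_span_singleton_smul, Submodule.mem_smul_pointwise_iff_exists]
        exact ⟨⟨y, hyt⟩, Submodule.mem_top, Subtype.ext (by rw [Submodule.coe_smul]; exact hy)⟩
      · rw [h𝔞, augIdealP, Submodule.ideal_span_singleton_smul]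
        rintro x hx
        rw [Submodule.mem_smul_pointwise_iff_exists] at hx
        obtain ⟨y, -, rfl⟩ := hx
        rw [LinearMap.mem_ker, LinearMap.comp_apply, Submodule.coe_subtype, Submodule.mkQ_apply,
          Submodule.Quotient.mk_eq_zero, hP, h𝔞, augIdealP, Submodule.ideal_span_singleton_smul,
          Submodule.coe_smul, Submodule.mem_smul_pointwise_iff_exists]
        exact ⟨y, Submodule.mem_top, rfl⟩
    have hrange : LinearMap.range κ = W' := by rw [LinearMap.range_comp, Submodule.range_subtype]
    have e : (t ⧸ (𝔞 • (⊤ : Submodule (IwasawaAlgebra p) t))) ≃ₗ[IwasawaAlgebra p] W' :=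
      (Submodule.quotEquivOfEq _ _ hker.symm).trans ((LinearMap.quotKerEquivRange κ).trans
        (LinearEquiv.ofEq _ _ hrange))
    exact Finite.of_equiv W' e.toEquiv.symm
  -- (c) transport `V` to `Ω = 𝔽_p⟦X⟧` and apply the rank-two growth bound
  let k := IsLocalRing.ResidueField ℤ_[p]
  haveI : Finite k := Finite.of_equiv _ (PadicInt.residueField (p := p)).toEquiv.symm
  let φ : IwasawaAlgebra p →+* PowerSeries k := PowerSeries.map (IsLocalRing.residue ℤ_[p])
  have hφ : Function.Surjective φ := PowerSeries.map_surjective _ IsLocalRing.residue_surjective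
  have hpV : ∀ v : V, (PowerSeries.C (p : ℤ_[p]) : IwasawaAlgebra p) • v = 0 := by
    intro v
    induction v using Submodule.Quotient.induction_on with
    | H x =>
      rw [← Submodule.Quotient.mk_smul, Submodule.Quotient.mk_eq_zero, hP, h𝔞, augIdealP,
        Submodule.ideal_span_singleton_smul, Submodule.mem_smul_pointwise_iff_exists]
      exact ⟨x, Submodule.mem_top, rfl⟩
  letI instSMul : SMul (PowerSeries k) V := ⟨fun g x => Function.surjInv hφ g • x⟩
  have hsmul_def : ∀ (g : PowerSeries k) (x : V), g • x = Function.surjInv hφ g • x := fun _ _ => rfl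
  have hsmul : ∀ (c : IwasawaAlgebra p) (x : V), φ c • x = c • x := by
    intro c x
    rw [hsmul_def]
    have hcc : φ (Function.surjInv hφ (φ c) - c) = 0 := by rw [map_sub, Function.surjInv_eq hφ, sub_self]
    rw [map_residue_eq_zero_iff, augIdealP, Ideal.mem_span_singleton] at hcc
    obtain ⟨q, hq⟩ := hcc
    have : Function.surjInv hφ (φ c) = c + PowerSeries.C (p : ℤ_[p]) * q := by rw [← hq, add_sub_cancel]
    rw [this, add_smul, mul_comm, mul_smul, hpV, smul_zero, add_zero]
  letI instMod : Module (PowerSeries k) V := Function.Surjective.moduleLeft φ hφ hsmul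
  haveI : Module.Finite (PowerSeries k) V := by
    obtain ⟨s, hs⟩ := (inferInstance : Module.Finite (IwasawaAlgebra p) V).fg_top
    refine ⟨⟨s, ?_⟩⟩
    rw [eq_top_iff]
    intro x _
    have hx : x ∈ Submodule.span (IwasawaAlgebra p) (s : Set V) := by rw [hs]; exact Submodule.mem_top
    refine Submodule.span_induction (p := fun y _ => y ∈ Submodule.span (PowerSeries k) (s : Set V))
      (fun y hy => Submodule.subset_span hy) (Submodule.zero_mem _) (fun _ _ _ _ hy hz => Submodule.add_mem _ hy hz)
      (fun c y _ hy => ?_) hx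
    rw [← hsmul]
    exact Submodule.smul_mem _ _ hy
  -- `W'` as an `Ω`-submodule
  let W : Submodule (PowerSeries k) V :=
    { carrier := W'
      add_mem' := fun ha hb => W'.add_mem ha hb
      zero_mem' := W'.zero_mem
      smul_mem' := fun g x hx => by
        change Function.surjInv hφ g • x ∈ W'
        exact W'.smul_mem _ hx }
  have hWcarrier : ∀ x : V, x ∈ W ↔ x ∈ W' := fun _ => Iff.rfl
  haveI : IsNoetherian (PowerSeries k) V := isNoetherian_of_isNoetherianRing_of_finite _ _
  haveI : Module.Finite (PowerSeries k) W := Module.Finite.iff_fg.mpr (IsNoetherian.noetherian W)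
  have hW : ¬ Module.IsTorsion (PowerSeries k) W := by
    intro htor
    haveI := finite_of_isTorsion (k := k) htor
    haveI : Finite W' := Finite.of_equiv W (Equiv.subtypeEquivRight hWcarrier)
    exact not_finite W'
  haveI : Module.Finite (PowerSeries k) (V ⧸ W) := inferInstance
  have hQ : ¬ Module.IsTorsion (PowerSeries k) (V ⧸ W) := by
    intro htor
    haveI := finite_of_isTorsion (k := k) htor
    let e : (V ⧸ W) ≃ (V ⧸ W') := Quotient.congr (Equiv.refl V) fun a b => by
      rw [Submodule.quotientRel_def, Submodule.quotientRel_def, Equiv.refl_apply, Equiv.refl_apply]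
      exact hWcarrier (a - b)
    haveI : Finite (V ⧸ W') := Finite.of_equiv _ e
    exact not_finite (V ⧸ W')
  -- the bound at `m = p ^ n`, `n` with `p ^ n > C`
  obtain ⟨n, hn⟩ : ∃ n : ℕ, C < p ^ n := ⟨C, Nat.lt_pow_self (Fact.out : p.Prime).one_lt⟩
  have hbound := pow_mul_pow_le_natCard_quotient (k := k) W hW hQ (p ^ n)
  -- translate the `Ω`-quotient into the `Λ`-quotient of the hypothesis
  have hXT : φ ((PowerSeries.X : IwasawaAlgebra p) ^ (p ^ n)) = (PowerSeries.X : PowerSeries k) ^ (p ^ n) := by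
    rw [map_pow, PowerSeries.map_X]
  have hcarrier : ∀ y : V,
      y ∈ (Ideal.span {((PowerSeries.X : PowerSeries k) ^ (p ^ n))} • (⊤ : Submodule (PowerSeries k) V)) ↔
        y ∈ (Ideal.span {((PowerSeries.X : IwasawaAlgebra p) ^ (p ^ n))} • (⊤ : Submodule (IwasawaAlgebra p) V)) := by
    intro y
    rw [Submodule.ideal_span_singleton_smul, Submodule.ideal_span_singleton_smul,
      Submodule.mem_smul_pointwise_iff_exists, Submodule.mem_smul_pointwise_iff_exists]
    constructor
    · rintro ⟨x, -, rfl⟩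
      exact ⟨x, Submodule.mem_top, by rw [← hXT, hsmul]⟩
    · rintro ⟨x, -, rfl⟩
      exact ⟨x, Submodule.mem_top, by rw [← hXT, hsmul]⟩
  let e : (V ⧸ (Ideal.span {((PowerSeries.X : PowerSeries k) ^ (p ^ n))} • (⊤ : Submodule (PowerSeries k) V))) ≃
      (V ⧸ (Ideal.span {((PowerSeries.X : IwasawaAlgebra p) ^ (p ^ n))} • (⊤ : Submodule (IwasawaAlgebra p) V))) :=
    Quotient.congr (Equiv.refl V) fun a b => by
      rw [Submodule.quotientRel_def, Submodule.quotientRel_def, Equiv.refl_apply, Equiv.refl_apply]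
      exact hcarrier (a - b)
  rw [card_residueField_padicInt, Nat.card_congr e, ← pow_add] at hbound
  have hle := hbound.trans (hgrowth n)
  have := (Nat.pow_le_pow_iff_right (Fact.out : p.Prime).one_lt).mp hle
  omega

end Summit.BirchSwinnertonDyer.BirchSwinnertonDyer.Theorems.UniversalToricDescentResidualCorankOne

end
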